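import Summits.BirchSwinnertonDyer.BirchSwinnertonDyer.Theorems.InertBadSignedBranchesCccOneLawOnTypeIstarZeroMuDictionaryEta
import Literature.NumberTheory.EllipticCurves.Kato2004.GeneratorChange
import Literature.NumberTheory.EllipticCurves.ZpExtensionUnitTwistProofs
import Summits.BirchSwinnertonDyer.Rank1Residual.Additive.SignedTwistOddBranchReadings
import Summits.BirchSwinnertonDyer.Rank1Residual.Additive.QuadraticBranchPeriodRatioOfManinFact
import Summits.BirchSwinnertonDyer.Rank1Residual.X12.ClassClosureO10EtaBranch
import Literature.NumberTheory.EllipticCurves.KatoRankBoundProofs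
import HarnessLib

/-!
# Route `InertBadSignedBranches` (rung K8), crux 19223 `CccOneLawOnTypeIstarZero`, line `kato_perrin_riou_istar`:
# the `μ`-dictionary of `…CccOneLawOnTypeIstarZeroMuDictionaryEta` in stub 2b's FULL keying — every cyclotomic
# `ℤ_p`-extension datum `K` and every topological generator `γ` (generator change at the prime `(p)`) — and ON
# THE ROWS of the crux: stub 2b's registered signature with `∀ z₀ admissible` replaced by `∃ z` (a Kobayashi class)
# (helper `--supports stmt-BirchSwinnertonDyer-19223`)

HONEST FRAMING (refill hand `leafhand-bsd-inertbadsignedbran-3`, LAND-ONLY): BSD is NOT proved by any of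
this; nothing here closes a stub, an item or a cell; no definition, no new fact, no `sorry`; nothing is
booked.

WHAT. RESEARCH stub 2b `KatoPerrinRiouIstar.stub_katoMuEqualityIstarZero` quantifies over EVERY cyclotomic
`K : ZpExtension ℚ p`, EVERY topological generator `γ`, every pin `I : Kato2004.IwasawaH1Data W p K γ` and
every `Y : W.FineSelmerDualData K γ⁻¹`; the sibling file delivers its sentence (at Kobayashi's `η`-class) only in
the `η`-frame keying `(κ, γ)` of items 19501/19865 (`γ ∈ Gal(ℚ̄/ℚ(μ_p))` on the cyclotomic variable). This
file closes that bookkeeping gap («GC» of the hand's census), kernel only: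
* §1 `φ_c : T ↦ (1+T)^c − 1` fixes the prime `(p)`; hence (clones at `(p)` of the tree's `(T)`-lemmas
  `Kato2004.IwasawaH1Data.lengthAt_quotient_span_changeData_eq`, `FineSelmerDualData.lengthAt_changeData_primeT_eq`)
  `length_(p)` of `𝐇¹_Γ ⧸ Λz₀` and of `X₀` are unchanged by the change of datum/generator
  (`IwasawaH1Data.changeData`, `FineSelmerDualData.changeData`; Washington §13.2).
* §2 for every unit twist `κ.unitTwist c` of the frame's `κ` (= EVERY cyclotomic datum,
  `ZpExtension.IsCyclotomic.exists_eq_unitTwist_holds`), every generator `γ'` of it, every pin `I'` over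
  `(κ.unitTwist c, γ')`, every Kobayashi package `P` on the re-keyed pin `I'.changeData κ c _ _` and every
  `Y : W.FineSelmerDualData (κ.unitTwist c) γ'⁻¹`: granted 19867 + 19865,
  `length_(p) Y.X = length_(p) (I'.H ⧸ Λ∙P.z)` in `I'`'s OWN `Λ`-structure — stub 2b's sentence in stub 2b's
  binders, the admissible class replaced by Kobayashi's; and the `∃ z` form keyed to the named fact
  `Kobayashi2003.thm62_63_73_etaColemanPoitouTate` for every cyclotomic `K'`.
* §3 ON THE ROWS of crux 19223 (`p ≥ 5`, `HasSignedLocalType W p (I₀*)`): the `η`-frame is SUPPLIED from tree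
  theorems and print names exactly as the route's (K)-form heads do — the CM good-supersingular twin
  (`X12.O10.exists_goodTwist_pStar_of_hasSignedLocalType_IstarZero`), its newform (modularity
  `ModularForms.exists_isNewformOf` = the line's `stub_printFactsKato.2.1`), the period ratio (Mazur's `p ∤ c₀`,
  `ModularForms.mazur_not_dvd_maninConstant_of_odd`, via `Additive.periodRatio_of_mazur`), `K₀ = ℚ(μ_p)` with the
  quadratic `η` (`SignedTwist.exists_theta_eta_cyclotomicField`), a cyclotomic `(κ, γ)` on the cyclotomic variable
  inside `Gal(ℚ̄/K₀)` (`exists_isCyclotomic_isTopGenerator_isCyclotomicVariable_holds`,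
  `Additive.kappa_surjOn_galRange_cyclotomic`, `SignedTwist.isCyclotomicVariable_of_inv_mul_mem_ker`). RESULT
  `exists_kobayashiClass_lengthAt_fine_eq_onType_IstarZero_of_plusMCEtaKMuPart` (and `…_of_plusMCEtaK`, keyed to the
  registered stub 6a): THE REGISTERED SIGNATURE OF STUB 2b with `(z₀ : I.H), IsAdmissibleZetaClass W p K hK I z₀ →`
  replaced by `∃ z : I.H,` (its `W.analyticRank = 1` binder is not needed), granted modularity, Mazur, 19867, 19865
  (resp. 19501) and the Kobayashi package fact.
* §4 conversely, stub 2b ITSELF (as the hypothesis `h2b`, verbatim) forces on the rows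
  `length_(p)(𝐇¹_Γ ⧸ Λ∙z₀) = length_(p)(𝐇¹_Γ ⧸ Λ∙z)` for every admissible `z₀` and the class `z` of §3.
So, granted those names, the residual content of stub 2b on the rows is EXACTLY «`μ(𝐇¹_Γ/Λz₀) = μ(𝐇¹_Γ/Λz)`
for every admissible `z₀`» (sufficient by §3, necessary by §4; e.g. `z₀ ∈ Λˣ·z`, the hand's «ZC») — NOT
asserted.

References: [Washington1997] §13.1–13.2; [GreenbergLNM1716] §1 p. 60; [Kobayashi2003] Thm. 6.2–6.3 (p. 11),
(7.21), proof of Thm. 7.4 (p. 13); [Kato2004Asterisque] §12.2 (p. 220), Conj. 12.10 (p. 224); [BurungaleTian2026]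
Rem. 2.7 (p. 5); [Mazur1978] Cor. 4.1; [SerreInventiones1972] §1.11 Prop. 12.
-/

set_option linter.dupNamespace false
set_option autoImplicit false

noncomputable section

open scoped Classical

open CongruenceSubgroup WeierstrassCurve Field Literature.NumberTheory.EllipticCurves
  Literature.NumberTheory.EllipticCurves.ModularForms Literature.NumberTheory.GaloisRepresentations
  Literature.NumberTheory.EllipticCurves.IwasawaAlgebra Literature.NumberTheory.EllipticCurves.Module
  Literature.NumberTheory.EllipticCurves.Kato2004 ZpExtension Summit.BirchSwinnertonDyer.Rank1Residual
  Summit.BirchSwinnertonDyer.Rank1Residual.Additive Summit.BirchSwinnertonDyer.Rank1Residual.X12.O10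
  Summit.BirchSwinnertonDyer.BirchSwinnertonDyer.Theses.InertBadSignedBranches

namespace Summit.BirchSwinnertonDyer.BirchSwinnertonDyer.Theorems.CccOneMuDictionaryEta

variable {p : ℕ} [Fact p.Prime]

/-! ## §1 Generator change at the prime `(p)` -/

/-- **`φ_c` fixes the prime `(p)` of `Spec Λ`** (`φ_c` is a `ℤ_p`-algebra automorphism, so it fixes the
constant `C p`; companion of the tree's `GeneratorChange.comapEquiv_substEquiv_primeT`).
[cite: Washington1997, §13.2] -/
theorem comapEquiv_substEquiv_eq_self_of_asIdeal_eq_augIdealP (c : ℤ_[p]ˣ)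
    (𝔭 : PrimeSpectrum (IwasawaAlgebra p)) (h𝔭 : 𝔭.asIdeal = augIdealP p) :
    PrimeSpectrum.comapEquiv (GeneratorChange.substEquiv c) 𝔭 = 𝔭 := by
  ext f
  rw [PrimeSpectrum.comapEquiv_apply, PrimeSpectrum.comap_asIdeal, Ideal.mem_comap, h𝔭, augIdealP,
    Ideal.mem_span_singleton, Ideal.mem_span_singleton]
  change (PowerSeries.C (p : ℤ_[p]) : IwasawaAlgebra p) ∣ (GeneratorChange.substEquiv c).symm f ↔ _
  constructor
  · intro h
    have := map_dvd (GeneratorChange.substEquiv c) h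
    rwa [RingEquiv.apply_symm_apply, GeneratorChange.substEquiv_apply, GeneratorChange.subst_C] at this
  · intro h
    have := map_dvd (GeneratorChange.substEquiv c).symm h
    rwa [GeneratorChange.substEquiv_symm_apply, GeneratorChange.subst_C] at this

section H1

variable {W : WeierstrassCurve ℚ} [W.IsElliptic] [ContinuousSMul ℤ_[p] (W.tateModule p)]
  (κ₀ : ZpExtension ℚ p) (c : ℤ_[p]ˣ) {γ γ₀ : absoluteGaloisGroup ℚ}
  (I : Kato2004.IwasawaH1Data W p (κ₀.unitTwist c) γ)
  (hγ : (κ₀.unitTwist c).IsTopGenerator γ) (hγ₀ : κ₀.IsTopGenerator γ₀)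

/-- **`length_(p)(𝐇¹_Γ ⧸ Λz₀)` is unchanged by the change of datum/generator** (the identity
`(I.changeData …).H = I.H` is semilinear over `φ_c`, which fixes `(p)`; adapted from the tree's `(T)`-case
`Kato2004.IwasawaH1Data.lengthAt_quotient_span_changeData_eq`). [cite: Washington1997, §13.2]
[cite: Kato2004Asterisque, §12.2 (p. 220)] -/
theorem lengthAt_quotient_span_changeData_eq_of_asIdeal_eq_augIdealP (z₀ : I.H)
    (𝔭 : PrimeSpectrum (IwasawaAlgebra p)) (h𝔭 : 𝔭.asIdeal = augIdealP p) :
    Module.lengthAt (IwasawaAlgebra p)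
        ((I.changeData κ₀ c hγ hγ₀).H ⧸ Submodule.span (IwasawaAlgebra p)
          {(show (I.changeData κ₀ c hγ hγ₀).H from z₀)}) 𝔭 =
      Module.lengthAt (IwasawaAlgebra p) (I.H ⧸ Submodule.span (IwasawaAlgebra p) {z₀}) 𝔭 := by
  -- adapted from Literature/NumberTheory/EllipticCurves/Kato2004/GeneratorChange.lean (the `(T)` case)
  set σ : IwasawaAlgebra p ≃+* IwasawaAlgebra p := GeneratorChange.substEquiv c with hσ
  set S₀ : Submodule (IwasawaAlgebra p) (I.changeData κ₀ c hγ hγ₀).H :=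
    Submodule.span (IwasawaAlgebra p) {(show (I.changeData κ₀ c hγ hγ₀).H from z₀)} with hS₀
  set S : Submodule (IwasawaAlgebra p) I.H := Submodule.span (IwasawaAlgebra p) {z₀} with hS
  let idₛ : (I.changeData κ₀ c hγ hγ₀).H →ₛₗ[(σ : IwasawaAlgebra p →+* IwasawaAlgebra p)] I.H :=
    { toFun := fun x ↦ (show I.H from x)
      map_add' := fun _ _ ↦ rfl
      map_smul' := fun _ _ ↦ rfl }
  have hidₛ : ∀ x, idₛ x = (show I.H from x) := fun _ ↦ rfl
  have hle : S₀ ≤ S.comap idₛ := by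
    rw [hS₀, Submodule.span_le, Set.singleton_subset_iff, SetLike.mem_coe, Submodule.mem_comap, hidₛ]
    exact Submodule.mem_span_singleton_self z₀
  let e := Submodule.mapQ S₀ S idₛ hle
  have he_mk : ∀ x : (I.changeData κ₀ c hγ hγ₀).H,
      e (Submodule.Quotient.mk x) = Submodule.Quotient.mk (show I.H from x) := fun _ ↦ rfl
  have hsurj : Function.Surjective e := by
    intro y
    induction y using Submodule.Quotient.induction_on with
    | H x => exact ⟨Submodule.Quotient.mk (show (I.changeData κ₀ c hγ hγ₀).H from x), he_mk _⟩
  have hinj : Function.Injective e := by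
    rw [← LinearMap.ker_eq_bot, LinearMap.ker_eq_bot']
    intro m hm
    induction m using Submodule.Quotient.induction_on with
    | H x =>
      rw [he_mk, Submodule.Quotient.mk_eq_zero, hS, Submodule.mem_span_singleton] at hm
      obtain ⟨r, hr⟩ := hm
      rw [Submodule.Quotient.mk_eq_zero, hS₀, Submodule.mem_span_singleton]
      refine ⟨σ.symm r, ?_⟩
      rw [Kato2004.IwasawaH1Data.changeData_smul, ← hσ, RingEquiv.apply_symm_apply]
      exact hr
  let e' : ((I.changeData κ₀ c hγ hγ₀).H ⧸ S₀) ≃+ (I.H ⧸ S) :=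
    AddEquiv.ofBijective e.toAddMonoidHom ⟨hinj, hsurj⟩
  have he' : ∀ (r : IwasawaAlgebra p) (m : (I.changeData κ₀ c hγ hγ₀).H ⧸ S₀),
      e' (r • m) = σ r • e' m :=
    fun r m ↦ e.map_smulₛₗ r m
  rw [lengthAt_eq_of_semilinearEquiv σ e' he' 𝔭, hσ,
    comapEquiv_substEquiv_eq_self_of_asIdeal_eq_augIdealP c 𝔭 h𝔭]

end H1

section Fine

variable {W : WeierstrassCurve ℚ} (κ₀ : ZpExtension ℚ p) (c : ℤ_[p]ˣ)
  {γ γ₀ : absoluteGaloisGroup ℚ} (Y : W.FineSelmerDualData (κ₀.unitTwist c) γ)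
  (hγ : (κ₀.unitTwist c).IsTopGenerator γ) (hγ₀ : κ₀.IsTopGenerator γ₀)

/-- **`length_(p)(X₀)` is unchanged by the change of datum/generator** (adapted from the tree's `(T)`-case
`WeierstrassCurve.FineSelmerDualData.lengthAt_changeData_primeT_eq`). [cite: Washington1997, §13.2]
[cite: GreenbergLNM1716, §1 p. 60] -/
theorem lengthAt_changeData_eq_of_asIdeal_eq_augIdealP
    (𝔭 : PrimeSpectrum (IwasawaAlgebra p)) (h𝔭 : 𝔭.asIdeal = augIdealP p) :
    Module.lengthAt (IwasawaAlgebra p) (Y.changeData κ₀ c hγ hγ₀).X 𝔭 =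
      Module.lengthAt (IwasawaAlgebra p) Y.X 𝔭 := by
  have h := lengthAt_eq_of_semilinearEquiv (GeneratorChange.substEquiv c)
    (show (Y.changeData κ₀ c hγ hγ₀).X ≃+ Y.X from AddEquiv.refl Y.X) (fun _ _ ↦ rfl) 𝔭
  rwa [comapEquiv_substEquiv_eq_self_of_asIdeal_eq_augIdealP c 𝔭 h𝔭] at h

end Fine

/-! ## §2 Stub 2b's sentence at Kobayashi's class in stub 2b's FULL keying (every cyclotomic `K`, every `γ`) -/

section Frame

variable (hp : p ≠ 2) (K₀ : Type) [Field K₀] [NumberField K₀]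
  [IsCyclotomicExtension {p} ℚ K₀] [(galRange (K := ℚ) K₀).Normal]
  (η : absoluteGaloisGroup ℚ →* ℤˣ) (hη : ∀ σ ∈ galRange (K := ℚ) K₀, η σ = 1) (hη1 : η ≠ 1)
  (V : WeierstrassCurve ℚ) [V.IsElliptic] [V.IsGloballyMinimal] {N : ℕ} [NeZero N]
  {f : CuspForm (Gamma0 N) 2} (hCM : V.HasCM) (hgood : V.HasGoodReductionAtPrime p)
  (hap : V.frobeniusTrace p = 0) (hf : IsNewformOf V f) (ϖ : ℚ)
  (hϖ : if Even (p / 2) then (ϖ : ℝ) * V.realPeriodRat = plusPeriod f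
    else (ϖ : ℝ) * V.imaginaryPeriodRat = minusPeriod f)
  (κ : ZpExtension ℚ p) (γ : absoluteGaloisGroup ℚ) (hκ : κ.IsCyclotomic) (hγ : κ.IsTopGenerator γ)
  (hγK : γ ∈ galRange (K := ℚ) K₀) (hvar : IsCyclotomicVariable p γ)
  (W : WeierstrassCurve ℚ) [W.IsElliptic] [ContinuousSMul ℤ_[p] (W.tateModule p)]

include hp hη hη1 hCM hgood hap hf hϖ hκ hγ hγK hvar

/-- **Stub 2b's sentence at Kobayashi's class, for a pin over ANY unit twist `κ.unitTwist c` of the frame's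
`κ` and ANY generator `γ'` of it (kernel, by name from the route).** Granted 19867 `PublishedInputsEtaUpToP`
and 19865 `PlusMCEtaKMuPart`: for every CM `η`-frame, every `c : ℤ_pˣ`, every topological generator `γ'` of
`κ.unitTwist c`, every pin `I' : 𝐇¹_Γ(T_pW)` keyed `(κ.unitTwist c, γ')`, every key-`(κ, γ)` datum `FB` with a
Kobayashi package `P` on the RE-KEYED pin `I'.changeData κ c _ _` (same group `I'.H`), every
`Y : W.FineSelmerDualData (κ.unitTwist c) γ'⁻¹` and every prime `𝔮 = (p)`:
`length_𝔮 Y.X = length_𝔮 (I'.H ⧸ Λ∙P.z)`, the quotient in `I'`'s OWN `Λ`-structure. Chain: `Y` ↔ a key-`γ'`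
datum (ι-twist, `Kato2004.fineSelmerDualData_lengthAt_inv_eq`, `ι` fixes `(p)`) ↔ its `changeData` (§1) ↔ `FB`
(uniqueness `FineSelmerDualData.nonempty_linearEquiv`) = sibling §4 at the re-keyed pin ↔ `I'` (§1).
[cite: Washington1997, §13.2] [cite: GreenbergLNM1716, §1 p. 60] [cite: Kobayashi2003, proof of Thm. 7.4 (p. 13)]
[cite: Kato2004Asterisque, Conj. 12.10 (p. 224)] -/
theorem lengthAt_contra_fine_eq_lengthAt_quotient_unitTwist_of_plusMCEtaKMuPart
    (hF : PublishedInputsEtaUpToP) (hμ : PlusMCEtaKMuPart) (c : ℤ_[p]ˣ) {γ' : absoluteGaloisGroup ℚ}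
    (hγ' : (κ.unitTwist c).IsTopGenerator γ') (I' : Kato2004.IwasawaH1Data W p (κ.unitTwist c) γ')
    (FB : W.FineSelmerDualData κ γ)
    (P : Kobayashi2003.EtaColemanPoitouTateData p K₀ η V f ϖ κ γ W (I'.changeData κ c hγ' hγ) FB)
    (Y : W.FineSelmerDualData (κ.unitTwist c) γ'⁻¹)
    (𝔮 : PrimeSpectrum (IwasawaAlgebra p)) (h𝔮 : 𝔮.asIdeal = augIdealP p) :
    Module.lengthAt (IwasawaAlgebra p) Y.X 𝔮 =
      Module.lengthAt (IwasawaAlgebra p)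
        (I'.H ⧸ Submodule.span (IwasawaAlgebra p) {(show I'.H from P.z)}) 𝔮 := by
  -- the sibling's §4 at the re-keyed pin
  have h4 := lengthAt_fine_eq_lengthAt_quotient_of_plusMCEtaKMuPart hp K₀ η hη hη1 V hCM hgood hap hf ϖ hϖ
    κ γ hκ hγ hγK hvar W (I'.changeData κ c hγ' hγ) FB P hF hμ 𝔮 h𝔮
  -- right end: back to `I'`'s own `Λ`-structure (§1)
  rw [lengthAt_quotient_span_changeData_eq_of_asIdeal_eq_augIdealP κ c I' hγ' hγ (show I'.H from P.z) 𝔮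
    h𝔮] at h4
  -- left end: `Y` (key `γ'⁻¹`) ↔ a key-`γ'` datum ↔ its re-keying ↔ `FB`
  obtain ⟨Y''⟩ := W.nonempty_fineSelmerDualData (κ.unitTwist c) hγ'
  obtain ⟨e⟩ := WeierstrassCurve.FineSelmerDualData.nonempty_linearEquiv (Y''.changeData κ c hγ' hγ) FB
  rw [Kato2004.fineSelmerDualData_lengthAt_inv_eq Y'' Y 𝔮,
    IwasawaAlgebra.comap_invol_eq_self_of_asIdeal_eq_augIdealP p 𝔮 h𝔮,
    ← lengthAt_changeData_eq_of_asIdeal_eq_augIdealP κ c Y'' hγ' hγ 𝔮 h𝔮,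
    Module.lengthAt_eq_of_linearEquiv e 𝔮, h4]

/-- **The `∃ z` form for EVERY cyclotomic datum `K'` and EVERY generator `γ'` — stub 2b's binders verbatim,
the admissible class replaced by a Kobayashi class (kernel, by name; keyed to the named fact
`Kobayashi2003.thm62_63_73_etaColemanPoitouTate`).** Granted that fact, 19867 and 19865: for every CM
`η`-frame, every model `W` of `V^{(p*)}` (`C • W.quadraticTwist p* = V`), every cyclotomic `K'`, every
topological generator `γ'` of `K'` and every pin `I' : Kato2004.IwasawaH1Data W p K' γ'`, SOME `z ∈ 𝐇¹_Γ(T_pW)`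
satisfies `length_(p) Y.X = length_(p)(𝐇¹_Γ ⧸ Λ∙z)` for EVERY `Y : W.FineSelmerDualData K' γ'⁻¹`. The witness
is Kobayashi's `η`-class of a package on the re-keyed pin (`K' = κ.unitTwist c` by
`ZpExtension.IsCyclotomic.exists_eq_unitTwist_holds`; previous theorem). Compare
`KatoPerrinRiouIstar.stub_katoMuEqualityIstarZero` («for every ADMISSIBLE `z₀`», at every height-one
`𝔮 = (p)`): what separates the two is «`μ(𝐇¹_Γ/Λz₀) = μ(𝐇¹_Γ/Λz)` for every admissible `z₀`» — NOT asserted.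
[cite: Washington1997, §13.1–13.2] [cite: Kobayashi2003, Thm. 6.2–6.3 (p. 11), (7.21) and proof of Thm. 7.4 (p. 13)]
[cite: Kato2004Asterisque, Conj. 12.10 (p. 224)] [cite: BurungaleTian2026, Rem. 2.7 (p. 5)] -/
theorem exists_kobayashiClass_lengthAt_contra_fine_eq_of_isCyclotomic_of_plusMCEtaKMuPart
    (hF : PublishedInputsEtaUpToP) (hμ : PlusMCEtaKMuPart)
    (hT : Kobayashi2003.thm62_63_73_etaColemanPoitouTate)
    (C : VariableChange ℚ) (hW : C • W.quadraticTwist ((-1) ^ (p / 2) * p) = V)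
    (K' : ZpExtension ℚ p) (hK' : K'.IsCyclotomic) {γ' : absoluteGaloisGroup ℚ}
    (hγ' : K'.IsTopGenerator γ') (I' : Kato2004.IwasawaH1Data W p K' γ') :
    ∃ z : I'.H, ∀ (Y : W.FineSelmerDualData K' γ'⁻¹) (𝔮 : PrimeSpectrum (IwasawaAlgebra p)),
      𝔮.asIdeal = augIdealP p →
        Module.lengthAt (IwasawaAlgebra p) Y.X 𝔮 =
          Module.lengthAt (IwasawaAlgebra p) (I'.H ⧸ Submodule.span (IwasawaAlgebra p) {z}) 𝔮 := by
  obtain ⟨c, rfl⟩ := ZpExtension.IsCyclotomic.exists_eq_unitTwist_holds hκ hK'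
  obtain ⟨FB⟩ := W.nonempty_fineSelmerDualData κ hγ
  obtain ⟨P⟩ :=
    hT p K₀ η hη hη1 V hp hgood hap hf ϖ hϖ κ γ hκ hγ hγK hvar W C hW (I'.changeData κ c hγ' hγ) FB
  exact ⟨(show I'.H from P.z), fun Y 𝔮 h𝔮 =>
    lengthAt_contra_fine_eq_lengthAt_quotient_unitTwist_of_plusMCEtaKMuPart hp K₀ η hη hη1 V hCM hgood hap hf
      ϖ hϖ κ γ hκ hγ hγK hvar W hF hμ c hγ' I' FB P Y 𝔮 h𝔮⟩

end Frame

/-! ## §3 On the rows of crux 19223: stub 2b's registered signature with `∀ z₀ admissible` ↦ `∃ z` -/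

/-- **Stub 2b ON THE ROWS with the admissible class replaced by a Kobayashi class (kernel, by name).**
Granted modularity (`hnf`), Mazur's `p ∤ c₀` (`hM`, for the period ratio), 19867 `PublishedInputsEtaUpToP`,
19865 `PlusMCEtaKMuPart` and the package fact `Kobayashi2003.thm62_63_73_etaColemanPoitouTate`: for every
`p ≥ 5`, every globally minimal `W/ℚ` with `HasSignedLocalType W p (I₀*)`, every cyclotomic `K`, every
topological generator `γ` and every pin `I : 𝐇¹_Γ(T_pW)`, there is `z ∈ 𝐇¹_Γ(T_pW)` (a Kobayashi `η`-class of
the good twin, re-keyed — siblings) with `length_𝔮 Y.X = length_𝔮 (𝐇¹_Γ ⧸ Λ∙z)` for every contragredient dual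
fine Selmer datum `Y` and every height-one `𝔮 = (p)`. Binders = those of
`KatoPerrinRiouIstar.stub_katoMuEqualityIstarZero` minus `W.analyticRank = 1`, with `∃ z` for
`∀ z₀ admissible`. [cite: Kobayashi2003, Thm. 6.2–6.3 (p. 11), (7.21) and proof of Thm. 7.4 (p. 13)]
[cite: Kato2004Asterisque, Conj. 12.10 (p. 224)] [cite: Mazur1978, Cor. 4.1] [cite: Washington1997, §13.1–13.2]
[cite: SerreInventiones1972, §1.11 Prop. 12] -/
theorem exists_kobayashiClass_lengthAt_fine_eq_onType_IstarZero_of_plusMCEtaKMuPart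
    (hnf : exists_isNewformOf) (hM : mazur_not_dvd_maninConstant_of_odd)
    (hF : PublishedInputsEtaUpToP) (hμ : PlusMCEtaKMuPart)
    (hT : Kobayashi2003.thm62_63_73_etaColemanPoitouTate) :
    ∀ (p : ℕ) [Fact p.Prime], 5 ≤ p → ∀ (W : WeierstrassCurve ℚ) [W.IsElliptic] [W.IsGloballyMinimal],
      HasSignedLocalType W p (.Istar 0) →
      letI : ContinuousSMul ℤ_[p] (W.tateModule p) := TateModule.continuousSMul_padicInt
      ∀ (K : ZpExtension ℚ p) (hK : K.IsCyclotomic) (γ : Field.absoluteGaloisGroup ℚ) (_ : K.IsTopGenerator γ)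
        (I : IwasawaH1Data W p K γ), ∃ z : I.H,
        ∀ (Y : W.FineSelmerDualData K γ⁻¹) (𝔮 : PrimeSpectrum (IwasawaAlgebra p)), 𝔮.asIdeal.height = 1 →
          𝔮.asIdeal = IwasawaAlgebra.augIdealP p →
          Module.lengthAt (IwasawaAlgebra p) Y.X 𝔮 =
            Module.lengthAt (IwasawaAlgebra p) (I.H ⧸ (IwasawaAlgebra p) ∙ z) 𝔮 := by
  intro p _ hp5 W _ _ hTy K hK γ₀ hγ₀ I
  letI : ContinuousSMul ℤ_[p] (W.tateModule p) := TateModule.continuousSMul_padicInt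
  have hp2 : p ≠ 2 := by omega
  -- the CM good-supersingular twin, its newform (modularity), its period ratio (Mazur)
  obtain ⟨V, hVe, hVm, C, hC, hgood, hap, hCM, -, -⟩ :=
    exists_goodTwist_pStar_of_hasSignedLocalType_IstarZero W hTy hp5
  haveI : NeZero (V.conductorNorm ℤ) := ⟨(V.conductorNorm_pos_holds).ne'⟩
  obtain ⟨f, hf⟩ := hnf V
  obtain ⟨ϖ, -, hϖ⟩ := periodRatio_of_mazur p hM hp5 V f hf hgood hap
  -- the η-frame: `K₀ = ℚ(μ_p)`, the quadratic `η`, a cyclotomic `(κ, γ)` on the cyclotomic variable inside `Gal(ℚ̄/K₀)`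
  haveI : NeZero p := ⟨(Fact.out : p.Prime).ne_zero⟩
  haveI : IsCyclotomicExtension {p} ℚ (CyclotomicField p ℚ) := CyclotomicField.isCyclotomicExtension p ℚ
  haveI : (galRange (K := ℚ) (CyclotomicField p ℚ)).Normal := normal_galRange_cyclotomic p _
  obtain ⟨θ, η, -, -, -, hηK, hη1⟩ := SignedTwist.exists_theta_eta_cyclotomicField p hp2
  obtain ⟨κ, hκ, γ₁, hγ₁, hγ₁c⟩ := exists_isCyclotomic_isTopGenerator_isCyclotomicVariable_holds p
  obtain ⟨γ, hγK, hγκ⟩ := kappa_surjOn_galRange_cyclotomic κ (CyclotomicField p ℚ) (κ γ₁)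
  have hγ : κ.IsTopGenerator γ := by rw [ZpExtension.IsTopGenerator, hγκ]; exact hγ₁
  have hγγ : γ₁⁻¹ * γ ∈ κ.kerSubgroup := by
    rw [ZpExtension.mem_kerSubgroup, map_mul, map_inv, hγκ, inv_mul_cancel]
  have hγc : IsCyclotomicVariable p γ := SignedTwist.isCyclotomicVariable_of_inv_mul_mem_ker hκ hγγ hγ₁c
  -- the siblings, in stub 2b's keying `(K, γ₀)`
  obtain ⟨z, hz⟩ := exists_kobayashiClass_lengthAt_contra_fine_eq_of_isCyclotomic_of_plusMCEtaKMuPart hp2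
    (CyclotomicField p ℚ) η hηK hη1 V hCM hgood hap hf ϖ hϖ κ γ hκ hγ hγK hγc W hF hμ hT C hC K hK hγ₀ I
  exact ⟨z, fun Y 𝔮 _ h𝔮 => hz Y 𝔮 h𝔮⟩

/-- **The same keyed to the registered ROUTE-CRUX stub 6a `PlusMCEtaK` (item 19501) instead of its μ-part**
(19501 ⟹ 19865 pointwise through the kernel μ-criterion `PlusMCEtaKUpToMu.plusMCEtaK_iff_muInvariant_eq_of_burungaleTian`,
granted 19867). [cite: Kobayashi2003, proof of Thm. 7.4 (p. 13), §4 (p. 8)] [cite: BurungaleTian2026, Thm. 2.6 and Rem. 2.7 (p. 5)]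
[cite: Mazur1978, Cor. 4.1] -/
theorem exists_kobayashiClass_lengthAt_fine_eq_onType_IstarZero_of_plusMCEtaK
    (hnf : exists_isNewformOf) (hM : mazur_not_dvd_maninConstant_of_odd)
    (hF : PublishedInputsEtaUpToP) (hK6 : PlusMCEtaK)
    (hT : Kobayashi2003.thm62_63_73_etaColemanPoitouTate) :
    ∀ (p : ℕ) [Fact p.Prime], 5 ≤ p → ∀ (W : WeierstrassCurve ℚ) [W.IsElliptic] [W.IsGloballyMinimal],
      HasSignedLocalType W p (.Istar 0) →
      letI : ContinuousSMul ℤ_[p] (W.tateModule p) := TateModule.continuousSMul_padicInt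
      ∀ (K : ZpExtension ℚ p) (hK : K.IsCyclotomic) (γ : Field.absoluteGaloisGroup ℚ) (_ : K.IsTopGenerator γ)
        (I : IwasawaH1Data W p K γ), ∃ z : I.H,
        ∀ (Y : W.FineSelmerDualData K γ⁻¹) (𝔮 : PrimeSpectrum (IwasawaAlgebra p)), 𝔮.asIdeal.height = 1 →
          𝔮.asIdeal = IwasawaAlgebra.augIdealP p →
          Module.lengthAt (IwasawaAlgebra p) Y.X 𝔮 =
            Module.lengthAt (IwasawaAlgebra p) (I.H ⧸ (IwasawaAlgebra p) ∙ z) 𝔮 := by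
  -- 19501 gives its μ-part 19865 (kernel μ-criterion, granted 19867)
  have hμ : PlusMCEtaKMuPart := by
    intro p _ hp K₀ _ _ _ _ η hη hη1 V _ _ N _ f hCM hgood hap hf ϖ hϖ κ γ hκ hγ hγK hvar Lp hLp D
    exact (PlusMCEtaKUpToMu.plusMCEtaK_iff_muInvariant_eq_of_burungaleTian hF.1 hF.2 p hp K₀ η hη hη1 V hCM
      hgood hap hf ϖ hϖ κ γ hκ hγ hγK hvar Lp hLp D).mp
      (hK6 p hp K₀ η hη hη1 V hCM hgood hap hf ϖ hϖ κ γ hκ hγ hγK hvar Lp hLp D)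
  exact exists_kobayashiClass_lengthAt_fine_eq_onType_IstarZero_of_plusMCEtaKMuPart hnf hM hF hμ hT


/-! ## §4 The necessity of «ZC at μ» for the line: stub 2b itself forces it on the rows -/

/-- **If RESEARCH stub 2b holds (hypothesis `h2b` = its registered statement VERBATIM), then on every row
every ADMISSIBLE class has the same `length_(p)(𝐇¹_Γ ⧸ Λ∙z₀)` as the Kobayashi class `z` of §3** (granted
modularity, Mazur, 19867, 19865 and the package fact): both equal `length_(p) Y.X` for any contragredient
datum `Y` (one exists for every key, `WeierstrassCurve.nonempty_fineSelmerDualData'`). So «`μ(𝐇¹_Γ/Λz₀) =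
μ(𝐇¹_Γ/Λz)` for every admissible `z₀`» is not only sufficient (§3) but NECESSARY for the line
`kato_perrin_riou_istar` to close with its registered stubs — the disprover's natural target. CONDITIONAL on
`h2b` (open); nothing is asserted. [cite: Kato2004Asterisque, Conj. 12.10 (p. 224)]
[cite: Kobayashi2003, proof of Thm. 7.4 (p. 13)] [cite: BurungaleTian2026, Rem. 2.7 (p. 5)] -/
theorem lengthAt_quotient_admissible_eq_kobayashiClass_of_stub2b
    (h2b : ∀ (p : ℕ) [Fact p.Prime], 5 ≤ p → ∀ (W : WeierstrassCurve ℚ) [W.IsElliptic] [W.IsGloballyMinimal],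
      HasSignedLocalType W p (.Istar 0) → W.analyticRank = 1 →
      letI : ContinuousSMul ℤ_[p] (W.tateModule p) := TateModule.continuousSMul_padicInt
      ∀ (K : ZpExtension ℚ p) (hK : K.IsCyclotomic) (γ : Field.absoluteGaloisGroup ℚ) (_ : K.IsTopGenerator γ)
        (I : IwasawaH1Data W p K γ) (z₀ : I.H), Kato2004.IsAdmissibleZetaClass W p K hK I z₀ →
        ∀ (Y : W.FineSelmerDualData K γ⁻¹) (𝔮 : PrimeSpectrum (IwasawaAlgebra p)), 𝔮.asIdeal.height = 1 →
          𝔮.asIdeal = IwasawaAlgebra.augIdealP p →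
          Module.lengthAt (IwasawaAlgebra p) Y.X 𝔮 =
            Module.lengthAt (IwasawaAlgebra p) (I.H ⧸ (IwasawaAlgebra p) ∙ z₀) 𝔮)
    (hnf : exists_isNewformOf) (hM : mazur_not_dvd_maninConstant_of_odd)
    (hF : PublishedInputsEtaUpToP) (hμ : PlusMCEtaKMuPart)
    (hT : Kobayashi2003.thm62_63_73_etaColemanPoitouTate) :
    ∀ (p : ℕ) [Fact p.Prime], 5 ≤ p → ∀ (W : WeierstrassCurve ℚ) [W.IsElliptic] [W.IsGloballyMinimal],
      HasSignedLocalType W p (.Istar 0) → W.analyticRank = 1 →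
      letI : ContinuousSMul ℤ_[p] (W.tateModule p) := TateModule.continuousSMul_padicInt
      ∀ (K : ZpExtension ℚ p) (hK : K.IsCyclotomic) (γ : Field.absoluteGaloisGroup ℚ) (_ : K.IsTopGenerator γ)
        (I : IwasawaH1Data W p K γ), ∃ z : I.H, ∀ (z₀ : I.H), Kato2004.IsAdmissibleZetaClass W p K hK I z₀ →
        ∀ (𝔮 : PrimeSpectrum (IwasawaAlgebra p)), 𝔮.asIdeal.height = 1 → 𝔮.asIdeal = IwasawaAlgebra.augIdealP p →
          Module.lengthAt (IwasawaAlgebra p) (I.H ⧸ (IwasawaAlgebra p) ∙ z₀) 𝔮 =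
            Module.lengthAt (IwasawaAlgebra p) (I.H ⧸ (IwasawaAlgebra p) ∙ z) 𝔮 := by
  intro p _ hp5 W _ _ hTy hr K hK γ₀ hγ₀ I
  letI : ContinuousSMul ℤ_[p] (W.tateModule p) := TateModule.continuousSMul_padicInt
  obtain ⟨z, hz⟩ := exists_kobayashiClass_lengthAt_fine_eq_onType_IstarZero_of_plusMCEtaKMuPart hnf hM hF hμ hT
    p hp5 W hTy K hK γ₀ hγ₀ I
  obtain ⟨Y⟩ := W.nonempty_fineSelmerDualData' K γ₀⁻¹
  refine ⟨z, fun z₀ hz₀ 𝔮 h1 h𝔮 => ?_⟩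
  rw [← h2b p hp5 W hTy hr K hK γ₀ hγ₀ I z₀ hz₀ Y 𝔮 h1 h𝔮, hz Y 𝔮 h1 h𝔮]

end Summit.BirchSwinnertonDyer.BirchSwinnertonDyer.Theorems.CccOneMuDictionaryEta

end
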